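import Summits.HubbardSuperconductivity.HubbardLadder.NeelSignPatternAllEven
import HarnessLib

/-!
# Odd-axis Néel signs from reflection-positivity principal minors: `c_L(0,5) < 0`, `c_L(0,7) < 0`, `c_L(0,9) < 0` on every even torus (HubbardLadder R2, H₀ line; pseudo F30)

HONEST FRAMING: ladder R1–R4 with certified numbers; no claim on H/H₀.

The reflection-positivity Gram form of the spin-½ Heisenberg antiferromagnet torus ground state,
`[-c(i+i'+1, t-t')]_{(i,t),(i',t')} ⪰ 0` for rows `i, i' < k` next to the reflection plane
(`heis_rpGramWindow_range`, Dyson–Lieb–Simon Theorem 4.2 / Kennedy–Lieb–Shastry eq. (25)), has the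
ODD axis correlations `-c(2i+1, 0)` on its diagonal.  Its `2 × 2` principal minor on the one-rung window
rows `{i, i'}` reads `c(2i+1,0) · c(2i'+1,0) ≥ c(i+i'+1,0)²`; written as the single row of the test vector
`(1, -r)` it is LINEAR in the correlations for every fixed rational `r`.  Fed with the landed strict sign
`c_L(0,3) ≤ -17/10000` on every even torus `L ≥ 4` (`heisRedCorr2_C03_ceiling_allEven`, device D42) —
`-11/5000` for `L = 2k ≥ 14` (`heisRedCorr2_C03_sign`, device D39) — Anderson's floor `-1/8 ≤ c_L(0,1)`
(`Literature.Barriers.HubbardSuperconductivity.neg_heisBondCorr_spinHalf_le`) and the box `|c| ≤ 1/4`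
(`heisRedCorr2_abs_le`), the minors `{0,2}`, `{1,3}`, `{0,4}` give, by `linarith` only:

* `heisRedCorr2_C05_sign (k) (hk : 7 ≤ k) : c_{2k}(0,5) ≤ -121/3125000` (`= -8·(11/5000)²`, `≈ -3.9·10⁻⁵`);
* `heisRedCorr2_C05_ceiling_allEven (L ≥ 6 even) : c_L(0,5) ≤ -23/10⁶` (`8·(17/10000)² = 2.312·10⁻⁵`);
* `heisRedCorr2_C07_ceiling_allEven (L ≥ 8 even) : c_L(0,7) ≤ -1/(5·10⁸)` (`4·(289/12500000)²`);
* `heisRedCorr2_C09_ceiling_allEven (L ≥ 10 even) : c_L(0,9) ≤ -1/(25·10⁷)` (`8·(289/12500000)²`).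

These extend the strict sign pattern `neelSignPattern_allEven` (`1 ≤ |a|+|b| ≤ 3`) to the axis displacements
`5, 7, 9` with `L`-UNIFORM (tiny) margins; on the small tori the displacement reduces mod `L`
(`(0,5) ≡ (0,1)` at `L = 6`, `≡ (0,3)` at `L = 8`; the statements stay true and are then not new).  What the
minors CANNOT do (recorded for the constraint-generation order of the dictionary LPs): the even-axis and
diagonal classes `(0,2s)`, `(s,s)` sit OFF the diagonal of the Gram form, so reflection positivity bounds only
their modulus (`c(4,s)² ≤ c(3,0)c(5,0)`), never their sign — those signs need the infrared (kernel) rows.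
Everything is proved; no named facts, no numerical input.
[cite: DLS1978, Theorem 4.2] [cite: KLS1988JSP, eq. (25)] [cite: Anderson1951, eq. (4)]
-/

namespace Summit.HubbardSuperconductivity.HubbardLadder

open Finset Literature.MathematicalPhysics.QuantumLattice Literature.Probability.LatticeModels

/-! ### The three one-rung test vectors -/

/-- Test vector `(1, 0, -625/11)` on the window rows `i = 0, 1, 2`, rung `t = 0`: the `{0,2}` principal minor of the
reflection-positivity Gram form at the ratio `r = (1/8)/(11/5000)`. [cite: DLS1978, Theorem 4.2] -/
noncomputable def rpMinorVec05 : ℕ → ℕ → ℝ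
  | 0, 0 => 1 | 2, 0 => (-625/11) | _, _ => 0

/-- Test vector `(1, 0, -1250/17)` on the window rows `i = 0, 1, 2`, rung `t = 0`: the `{0,2}` minor at the ratio
`r = (1/8)/(17/10000)` (all-even constant of `c(0,3)`). [cite: DLS1978, Theorem 4.2] -/
noncomputable def rpMinorVec05e : ℕ → ℕ → ℝ
  | 0, 0 => 1 | 2, 0 => (-1250/17) | _, _ => 0

/-- Test vector `(0, 1, 0, -3125000/289)` on the window rows `i = 0, …, 3`, rung `t = 0`: the `{1,3}` minor at the
ratio `r = (1/4)/(289/12500000)`. [cite: DLS1978, Theorem 4.2] -/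
noncomputable def rpMinorVec07 : ℕ → ℕ → ℝ
  | 1, 0 => 1 | 3, 0 => (-3125000/289) | _, _ => 0

/-- Test vector `(1, 0, 0, 0, -1562500/289)` on the window rows `i = 0, …, 4`, rung `t = 0`: the `{0,4}` minor at the
ratio `r = (1/8)/(289/12500000)`. [cite: DLS1978, Theorem 4.2] -/
noncomputable def rpMinorVec09 : ℕ → ℕ → ℝ
  | 0, 0 => 1 | 4, 0 => (-1562500/289) | _, _ => 0

/-! ### The minor rows (reflection positivity, one rung) -/

set_option maxHeartbeats 2000000 in
/-- `{0,2}` minor row at `r = 625/11`: `0 ≤ -c(0,1) + (1250/11) c(0,3) - (390625/121) c(0,5)` on every torus of side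
`2k`, `k ≥ 3` (`heis_rpGramWindow_range k 1 3 1`). [cite: DLS1978, Theorem 4.2] [cite: KLS1988JSP, eq. (25)] -/
theorem rpMinorRow05 (k : ℕ) (hk : 3 ≤ k) :
    haveI : NeZero (2 * k) := ⟨by omega⟩
    0 ≤ -heisRedCorr2 (2 * k) 1 0 1 + (1250/11 : ℝ) * heisRedCorr2 (2 * k) 1 0 3 -
      (390625/121 : ℝ) * heisRedCorr2 (2 * k) 1 0 5 := by
  haveI : NeZero (2 * k) := ⟨by omega⟩
  have hG := heis_rpGramWindow_range k 1 3 1 (by omega) rpMinorVec05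
  simp only [Finset.sum_range_succ, Finset.sum_range_zero, zero_add, rpMinorVec05] at hG
  norm_num [Int.natAbs] at hG
  rw [heisRedCorr2_swap (2 * k) 1 1 0, heisRedCorr2_swap (2 * k) 1 3 0, heisRedCorr2_swap (2 * k) 1 5 0] at hG
  linarith [hG]

set_option maxHeartbeats 2000000 in
/-- `{0,2}` minor row at `r = 1250/17`: `0 ≤ -c(0,1) + (2500/17) c(0,3) - (1562500/289) c(0,5)` on every torus of
side `2k`, `k ≥ 3`. [cite: DLS1978, Theorem 4.2] [cite: KLS1988JSP, eq. (25)] -/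
theorem rpMinorRow05e (k : ℕ) (hk : 3 ≤ k) :
    haveI : NeZero (2 * k) := ⟨by omega⟩
    0 ≤ -heisRedCorr2 (2 * k) 1 0 1 + (2500/17 : ℝ) * heisRedCorr2 (2 * k) 1 0 3 -
      (1562500/289 : ℝ) * heisRedCorr2 (2 * k) 1 0 5 := by
  haveI : NeZero (2 * k) := ⟨by omega⟩
  have hG := heis_rpGramWindow_range k 1 3 1 (by omega) rpMinorVec05e
  simp only [Finset.sum_range_succ, Finset.sum_range_zero, zero_add, rpMinorVec05e] at hG
  norm_num [Int.natAbs] at hG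
  rw [heisRedCorr2_swap (2 * k) 1 1 0, heisRedCorr2_swap (2 * k) 1 3 0, heisRedCorr2_swap (2 * k) 1 5 0] at hG
  linarith [hG]

set_option maxHeartbeats 2000000 in
/-- `{1,3}` minor row at `r = 3125000/289`: `0 ≤ -c(0,3) + (6250000/289) c(0,5) - (3125000/289)² c(0,7)` on every
torus of side `2k`, `k ≥ 4` (`heis_rpGramWindow_range k 1 4 1`). [cite: DLS1978, Theorem 4.2] [cite: KLS1988JSP, eq. (25)] -/
theorem rpMinorRow07 (k : ℕ) (hk : 4 ≤ k) :
    haveI : NeZero (2 * k) := ⟨by omega⟩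
    0 ≤ -heisRedCorr2 (2 * k) 1 0 3 + (6250000/289 : ℝ) * heisRedCorr2 (2 * k) 1 0 5 -
      (9765625000000/83521 : ℝ) * heisRedCorr2 (2 * k) 1 0 7 := by
  haveI : NeZero (2 * k) := ⟨by omega⟩
  have hG := heis_rpGramWindow_range k 1 4 1 (by omega) rpMinorVec07
  simp only [Finset.sum_range_succ, Finset.sum_range_zero, zero_add, rpMinorVec07] at hG
  norm_num [Int.natAbs] at hG
  rw [heisRedCorr2_swap (2 * k) 1 3 0, heisRedCorr2_swap (2 * k) 1 5 0, heisRedCorr2_swap (2 * k) 1 7 0] at hG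
  linarith [hG]

set_option maxHeartbeats 2000000 in
/-- `{0,4}` minor row at `r = 1562500/289`: `0 ≤ -c(0,1) + (3125000/289) c(0,5) - (1562500/289)² c(0,9)` on every
torus of side `2k`, `k ≥ 5` (`heis_rpGramWindow_range k 1 5 1`). [cite: DLS1978, Theorem 4.2] [cite: KLS1988JSP, eq. (25)] -/
theorem rpMinorRow09 (k : ℕ) (hk : 5 ≤ k) :
    haveI : NeZero (2 * k) := ⟨by omega⟩
    0 ≤ -heisRedCorr2 (2 * k) 1 0 1 + (3125000/289 : ℝ) * heisRedCorr2 (2 * k) 1 0 5 -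
      (2441406250000/83521 : ℝ) * heisRedCorr2 (2 * k) 1 0 9 := by
  haveI : NeZero (2 * k) := ⟨by omega⟩
  have hG := heis_rpGramWindow_range k 1 5 1 (by omega) rpMinorVec09
  simp only [Finset.sum_range_succ, Finset.sum_range_zero, zero_add, rpMinorVec09] at hG
  norm_num [Int.natAbs] at hG
  rw [heisRedCorr2_swap (2 * k) 1 1 0, heisRedCorr2_swap (2 * k) 1 5 0, heisRedCorr2_swap (2 * k) 1 9 0] at hG
  linarith [hG]

/-! ### Anderson's floor in window coordinates -/

/-- Anderson's lower bound in window coordinates: `-1/8 ≤ c_L(0,1)` (`L ≥ 3`).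
[cite: Anderson1951, eq. (4)] -/
theorem heisRedCorr2_C01_floor (L : ℕ) [NeZero L] (hL : 3 ≤ L) :
    -(1 / 8 : ℝ) ≤ heisRedCorr2 L 1 0 1 := by
  have h1 := Literature.Barriers.HubbardSuperconductivity.neg_heisBondCorr_spinHalf_le (d := 2)
    (by norm_num) L hL
  rw [heisBondCorr_two_eq, heisRedCorr2_swap L 1 1 0] at h1
  norm_num at h1 ⊢
  linarith

/-! ### The strict odd-axis signs -/

/-- **`c_{2k}(0,5) ≤ -121/3125000 ≈ -3.9·10⁻⁵` for every `k ≥ 7`**: the `{0,2}` reflection-positivity minor fed with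
the D39 kernel theorem `c(0,3) ≤ -11/5000` and Anderson's floor; `121/3125000 = 8·(11/5000)²`.  An `L`-uniform strict
Néel sign at distance `5`.  HONEST FRAMING: ladder R1–R4 with certified numbers; no claim on H/H₀.
[cite: DLS1978, Theorem 4.2] [cite: KLS1988JSP, eqs. (12)–(25)] [cite: Anderson1951, eq. (4)] -/
theorem heisRedCorr2_C05_sign (k : ℕ) (hk : 7 ≤ k) :
    haveI : NeZero (2 * k) := ⟨by omega⟩
    heisRedCorr2 (2 * k) 1 0 5 ≤ -(121 / 3125000 : ℝ) := by
  haveI : NeZero (2 * k) := ⟨by omega⟩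
  have hrow := rpMinorRow05 k (by omega)
  have h03 := heisRedCorr2_C03_sign k hk
  have h01 := heisRedCorr2_C01_floor (2 * k) (by omega)
  linarith

/-- **`c_L(0,5) ≤ -23/10⁶` on EVERY even torus `L ≥ 6`** (energy-free): the `{0,2}` reflection-positivity minor fed
with the all-even constant `c_L(0,3) ≤ -17/10000` (`heisRedCorr2_C03_ceiling_allEven`) and Anderson's floor;
`8·(17/10000)² = 2.312·10⁻⁵ ≥ 23/10⁶`.  (At `L = 6`, `(0,5) ≡ (0,1)`; at `L = 8`, `(0,5) ≡ (0,3)`.)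
HONEST FRAMING: ladder R1–R4 with certified numbers; no claim on H/H₀.
[cite: DLS1978, Theorem 4.2] [cite: KLS1988JSP, eqs. (12)–(25)] [cite: Anderson1951, eq. (4)] -/
theorem heisRedCorr2_C05_ceiling_allEven (L : ℕ) (hL : 6 ≤ L) (hev : Even L) :
    heisRedCorr2 L 1 0 5 ≤ -(23 / 1000000 : ℝ) := by
  have h03 := heisRedCorr2_C03_ceiling_allEven L (by omega) hev
  obtain ⟨k, rfl⟩ := hev
  rw [← two_mul] at h03 ⊢
  haveI : NeZero (2 * k) := ⟨by omega⟩
  have hrow := rpMinorRow05e k (by omega)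
  have h01 := heisRedCorr2_C01_floor (2 * k) (by omega)
  linarith

/-- **`c_L(0,7) ≤ -1/(5·10⁸)` on EVERY even torus `L ≥ 8`** (energy-free): the `{1,3}` reflection-positivity minor fed
with `c_L(0,5) ≤ -289/12500000` (the `{0,2}` minor) and the box `-c_L(0,3) ≤ 1/4`; `4·(289/12500000)² ≈ 2.14·10⁻⁹`.
HONEST FRAMING: ladder R1–R4 with certified numbers; no claim on H/H₀.
[cite: DLS1978, Theorem 4.2] [cite: KLS1988JSP, eqs. (12)–(25)] [cite: Anderson1951, eq. (4)] -/
theorem heisRedCorr2_C07_ceiling_allEven (L : ℕ) (hL : 8 ≤ L) (hev : Even L) :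
    heisRedCorr2 L 1 0 7 ≤ -(1 / 500000000 : ℝ) := by
  have h03 := heisRedCorr2_C03_ceiling_allEven L (by omega) hev
  obtain ⟨k, rfl⟩ := hev
  rw [← two_mul] at h03 ⊢
  haveI : NeZero (2 * k) := ⟨by omega⟩
  have hrow5 := rpMinorRow05e k (by omega)
  have hrow7 := rpMinorRow07 k (by omega)
  have h01 := heisRedCorr2_C01_floor (2 * k) (by omega)
  have hb3 : |heisRedCorr2 (2 * k) 1 0 3| ≤ 1 / 4 := by
    have := heisRedCorr2_abs_le (2 * k) 1 0 3
    norm_num at this ⊢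
    exact this
  obtain ⟨hl3, _hu3⟩ := abs_le.mp hb3
  nlinarith [hrow5, hrow7, h01, hl3, h03]

/-- **`c_L(0,9) ≤ -1/(25·10⁷)` on EVERY even torus `L ≥ 10`** (energy-free): the `{0,4}` reflection-positivity minor
fed with `c_L(0,5) ≤ -289/12500000` and Anderson's floor; `8·(289/12500000)² ≈ 4.28·10⁻⁹`.
HONEST FRAMING: ladder R1–R4 with certified numbers; no claim on H/H₀.
[cite: DLS1978, Theorem 4.2] [cite: KLS1988JSP, eqs. (12)–(25)] [cite: Anderson1951, eq. (4)] -/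
theorem heisRedCorr2_C09_ceiling_allEven (L : ℕ) (hL : 10 ≤ L) (hev : Even L) :
    heisRedCorr2 L 1 0 9 ≤ -(1 / 250000000 : ℝ) := by
  have h03 := heisRedCorr2_C03_ceiling_allEven L (by omega) hev
  obtain ⟨k, rfl⟩ := hev
  rw [← two_mul] at h03 ⊢
  haveI : NeZero (2 * k) := ⟨by omega⟩
  have hrow5 := rpMinorRow05e k (by omega)
  have hrow9 := rpMinorRow09 k (by omega)
  have h01 := heisRedCorr2_C01_floor (2 * k) (by omega)
  nlinarith [hrow5, hrow9, h01, h03]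

/-- **The odd-axis tail of the Néel sign pattern on every even torus `L ≥ 10`**: `c_L(0,5) ≤ -23/10⁶`,
`c_L(0,7) ≤ -1/(5·10⁸)`, `c_L(0,9) ≤ -1/(25·10⁷)` — strict, energy-free, `L`-uniform (reflection-positivity minors on
top of `neelSignPattern_allEven`).  HONEST FRAMING: ladder R1–R4 with certified numbers; no claim on H/H₀.
[cite: DLS1978, Theorem 4.2] [cite: KLS1988JSP, eqs. (12)–(25)] [cite: Anderson1951, eq. (4)] -/
theorem neelSignPattern_oddAxis_allEven (L : ℕ) (hL : 10 ≤ L) (hev : Even L) :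
    heisRedCorr2 L 1 0 5 ≤ -(23 / 1000000 : ℝ) ∧ heisRedCorr2 L 1 0 7 ≤ -(1 / 500000000 : ℝ) ∧
    heisRedCorr2 L 1 0 9 ≤ -(1 / 250000000 : ℝ) :=
  ⟨heisRedCorr2_C05_ceiling_allEven L (by omega) hev, heisRedCorr2_C07_ceiling_allEven L (by omega) hev,
    heisRedCorr2_C09_ceiling_allEven L hL hev⟩

end Summit.HubbardSuperconductivity.HubbardLadder
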